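import Literature.AlgebraicGeometry.ModuliOfAbelianVarieties.SymplecticLiftOfMarking
import Literature.AlgebraicGeometry.ModuliOfAbelianVarieties.SiegelAdmissibleFrameGram
import Literature.AlgebraicGeometry.ModuliOfAbelianVarieties.SiegelAdelicMarkingNormalForm
import Literature.AlgebraicGeometry.ModuliOfAbelianVarieties.SiegelAdelicMarkingOfAnalytification
import Literature.AlgebraicGeometry.AbelianSchemes.AbelianSchemeOverFibreDim
import Literature.Geometry.ComplexAnalytic.RelativeExponentialUniformisation
import Literature.Geometry.Kaehler.ComplexTorusHomLift
import Literature.AlgebraicGeometry.AbelianSchemes.AbelianSchemeFibreHom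
import HarnessLib

/-!
# FLAT-c «ADMISSIBLE OF CONSTANT READINGS»: along a chart of the total space, a frame with the SAME level readings and the SAME
# Weil-pairing readings as an admissible frame is itself admissible — the Riemann relations recovered from the readings
# ([BirkenhakeLange2004] §8.7 Lemma 8.7.1; [Milne2005ShimuraVarieties] Thm. 6.11; [Lan2013PELCompactifications] Lemma 1.3.6.5; [LangeBirkenhake1992] §4.2, §8.1)

Topic `Literature/AlgebraicGeometry/ModuliOfAbelianVarieties`; namespace `Literature.AlgebraicGeometry.ModuliOfAbelianVarieties`.
THEOREMS ONLY (no definition, no named fact, no instance, no notation, no `sorry`).  Cell `hodgecm-mathlib` (D-0151), FLOOR 0, P6 «MOD»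
(crux hLiu418 = stmt-HodgeConjecture-24832, `--supports`), half A line L7 (socket `stub_UNIVFAM` = ★ P-3 `siegelUniversalFamilyUniformisation`
→ in-house), sub-organ **FLAT-c** of the heart `stub_FLAT` of LA7-plan (g0)'s closer skeleton (v3 b58ad8870bbbf68b; FLAT RULING 02:22:01Z:
FLAT = a (★ NORM₀ p847957) + b(i) LEVEL + b(ii) PAIRING + c, interface owner LA7-p01 (g0), interface v1 02:3xZ).  HC_CM is proved only modulo the
printed citations (2 remaining named inputs hLiu418 24832, h413 24833) until rung 0 closes; this file is generic and changes no count.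

THE MATHEMATICS.  `P` a polarised abelian scheme with level-`N` structure of type `δ` over `T`, `(Φ₁, ex₁)` a chart of the total space read through
`φA` (a relative exponential chart in the skeleton; here only its frames `Φ₁ t : ℝ^{2g} ≃ ℂ^g` and fibre maps enter), `t₀`, `t` two points of the base.
HYPOTHESES: (G) at `t` (an additive analytification `φ_t` reading `ex₁ (t, ·)`); at `t₀` a FRAME PACKAGE — a marking `m₀` by `[J(Z₀), r]`, `r ∈ K_δ(1)`,
with `m₀.γ = 1`, `m₀.Ψ = Φ₁ t₀`, torus map `=` fibre map, an ample `IsLambdaOfAt` witness `Θ₀` and a symplectic lift `Λ₀` matched to `m₀.r` (★ NORM₀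
+ ★ ADM-NF); an ample `Θ` on `A_t`; and the two FLATNESS READINGS (the conclusions of FLAT-b, continuity over a connected base): (L=) the level sections
have at `t` the same chart coordinates as at `t₀`; (W=) the Weil pairings `ē^Θ_M` of the chart points at rational coordinates `v, w` at `t` equal the
Weil pairings `ē^{Θ₀}_M` of the chart points at the same coordinates at `t₀`, for every `M`.  CONCLUSION: `Z ∈ 𝔥_g` with `J_{Φ₁ t} = J(Z)` and a
frame package at `t` for `(Z, r)` — marking `⟨1, Φ₁ t, φ_t⟩` by `[J(Z), r]` and a symplectic lift of `(P.level, Θ)` at `t` matched to it.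
PROOF.  At `t₀` the integer Gram matrix of `c₁(Θ₀^an)` in the frame `m₀.Ψ` is `E_δ` (★ `intGram_eq_typeForm_of_symplecticLift`), so by D5 (★
`weilPairingLevel_eq_cexp_intGram`) the readings at `t₀` are `e(ᵗx̃ E_δ ỹ∕M)`; (W=) carries them to `t`; D5 at `t` and `M → ∞` give `intGram (Φ₁ t)
c₁(Θ^an) = E_δ` (§2), and since `c₁(Θ^an)` is a Riemann form (★ `isRiemannForm_of_isAmple`) the normal form with TRIVIAL base change (★
`exists_siegelAdelicMarking_normalForm`, read through ★ `ComplexTorus.exists_mapMatrix_linear_of_mdifferentiable`) gives `Z ∈ 𝔥_g` with `Φ₁ t`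
`ℂ`-linear for `J(Z)` — the Riemann relations.  The chart-frame marking has standard pairing readings (★ `exists_pairingRead_self_of_intGram_eq_typeForm`)
and, by (L=) and `Λ₀.lift_level` + the matched tower at `t₀`, standard level readings; ★ `exists_symplecticLift_of_levelReading` builds the lift.
The dimension bookkeeping `dim A_t = g` (★ `dim_fibre_of_isOfRelDim`) is done once per fibre by substitution (§2 is stated over `Fin g`).
* §1 `exists_torsionPoint_chart` (chart points at `x̃∕M` are `M`-torsion); arithmetic `e(a∕M) = e(b∕M) ∀ M ⇒ a = b`.
* §2 `weilPairingLevel_chart_eq_cexp` (D5 over `Fin g`), **`intGram_eq_typeForm_of_chartReadings`** (Gram `= E_δ` and `J(Z)`-linearity from readings).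
* §3 **`exists_framePackage_of_readings`** — THE HEAD (FLAT-c; hypotheses (L=)∕(W=) = the posted FLAT-b interface v1).

## References
* [BirkenhakeLange2004] C. Birkenhake, H. Lange, *Complex Abelian Varieties*, 2nd ed. (2004), §8.7 Lemma 8.7.1, §8.1 Prop. 8.1.1, §4.2 Thm. 4.2.1.
* [LangeBirkenhake1992] H. Lange, Ch. Birkenhake, *Complex Abelian Varieties* (1992), §1.1, §4.2, §8.1 Prop. 8.1.1.
* [Lange2023AbelianVarietiesComplex] H. Lange, *Abelian Varieties over the Complex Numbers* (2023), §1.5.1, §3.1.1; [Milne1986AbelianVarieties] §16.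
* [Milne2005ShimuraVarieties] J. S. Milne, *Introduction to Shimura Varieties* (2005), §6 Thm. 6.11 pp. 74–75, (63) p. 116.
* [Lan2013PELCompactifications] K.-W. Lan, *Arithmetic compactifications of PEL-type Shimura varieties* (2013), §1.3.6 Lemma 1.3.6.5 (p. 81).
-/

set_option autoImplicit false

noncomputable section

open CategoryTheory CategoryTheory.Limits AlgebraicGeometry Matrix Topology Function Complex
open scoped Manifold ContDiff Matrix.Norms.Elementwise Real
open Literature.AlgebraicGeometry.Motives (SchemeOver ComplexPoints AlgPoints specOver AbelianVariety CartierDivisor)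
open Literature.AlgebraicGeometry.AbelianSchemes (PolarizedAbelianSchemeWithLevel AbelianSchemeOver)
open Literature.Geometry.Kaehler (ComplexTorus)
open Literature.Geometry.Kaehler.ComplexTorus (AHData proj cover mapMatrix intGram picClass IsRiemannForm)
open Literature.Geometry.ComplexAnalytic (totalOver)
open Literature.NumberTheory.Transcendental (IsAnalytification)
open Literature.AlgebraicGeometry.HodgeTheory (cartierDivisorLineBundle)
open Literature.NumberTheory.Automorphic (siegelUpperHalfSpace)
open Literature.NumberTheory.Adeles

namespace Literature.AlgebraicGeometry.ModuliOfAbelianVarieties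

open SiegelModuli (jOfSiegel)

variable {g : ℕ} {δ : Fin g → ℕ}

/-! ### §1 Per-fibre readings -/
/-- An additive map out of a torus into a group sends `0` to `1`. [folklore] -/
private theorem map_zero_eq_one {ι : Type*} {E : Type*} [NormedAddCommGroup E] [NormedSpace ℂ E]
    {Φ : (ι → ℝ) ≃L[ℝ] E} {G : Type*} [Group G] {φ : ComplexTorus Φ → G} (hadd : ∀ x y, φ (x + y) = φ x * φ y) :
    φ 0 = 1 := by
  have h := hadd 0 0
  rw [add_zero] at h
  exact mul_left_cancel (a := φ 0) (by rw [← h, mul_one])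

/-- An additive map out of a torus sends `n • t` to the `n`-th power. [folklore] -/
private theorem map_nsmul_eq_pow {ι : Type*} {E : Type*} [NormedAddCommGroup E] [NormedSpace ℂ E]
    {Φ : (ι → ℝ) ≃L[ℝ] E} {G : Type*} [Group G] {φ : ComplexTorus Φ → G} (hadd : ∀ x y, φ (x + y) = φ x * φ y)
    (n : ℕ) (t : ComplexTorus Φ) : φ (n • t) = φ t ^ n := by
  induction n with
  | zero => rw [zero_smul, pow_zero, map_zero_eq_one hadd]
  | succ n ih => rw [succ_nsmul, hadd, ih, pow_succ]

/-- **The chart point at `x̃∕M` is `M`-torsion**: for an additive torus analytification `φ` of a complex abelian variety and an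
integer vector `x̃`, `φ [x̃∕M] ∈ A[M](ℂ)`. [cite: LangeBirkenhake1992, §1.1] -/
theorem exists_torsionPoint_chart (X : AbelianVariety ℂ) {Φ : (Fin g ⊕ Fin g → ℝ) ≃L[ℝ] (Fin g → ℂ)}
    {φ : ComplexTorus Φ → X.Points ℂ} (hadd : ∀ x y, φ (x + y) = φ x * φ y) {M : ℕ} (hM : M ≠ 0)
    (x : Fin g ⊕ Fin g → ℤ) :
    ∃ P : X.torsionPoints ℂ (M : ℤ), (P : X.Points ℂ) = φ (proj Φ ((M : ℝ)⁻¹ • fun i => (x i : ℝ))) := by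
  refine ⟨⟨φ (proj Φ ((M : ℝ)⁻¹ • fun i => (x i : ℝ))), ?_⟩, rfl⟩
  rw [AbelianVariety.mem_torsionPoints_iff, zpow_natCast, ← map_nsmul_eq_pow hadd]
  have hMr : (M : ℝ) ≠ 0 := Nat.cast_ne_zero.2 hM
  have hsmul : M • proj Φ ((M : ℝ)⁻¹ • fun i => (x i : ℝ)) = proj Φ (fun i => (x i : ℝ)) := by
    change M • ComplexTorus.projHom Φ _ = ComplexTorus.projHom Φ _
    rw [← map_nsmul, ← Nat.cast_smul_eq_nsmul ℝ, smul_smul, mul_inv_cancel₀ hMr, one_smul]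
  have hint : proj Φ (fun i => (x i : ℝ)) = 0 := (ComplexTorus.proj_eq_zero_iff (Φ := Φ)).2 ⟨x, rfl⟩
  rw [hsmul, hint, map_zero_eq_one hadd]

/-- Two integers with the same `e(·∕M)` for every level `M ≥ 1` are equal (take `M > |a - b|`). [folklore] -/
private theorem int_eq_of_forall_cexp_eq {a b : ℤ}
    (h : ∀ M : ℕ, M ≠ 0 → cexp (2 * π * I * (((a : ℝ) / M : ℝ) : ℂ)) = cexp (2 * π * I * (((b : ℝ) / M : ℝ) : ℂ))) :
    a = b := by
  set M : ℕ := (a - b).natAbs + 1 with hMdef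
  have hM : M ≠ 0 := Nat.succ_ne_zero _
  obtain ⟨n, hn⟩ := Complex.exp_eq_exp_iff_exists_int.1 (h M hM)
  have h2 : (2 * (π : ℂ) * I) ≠ 0 := by simp [Real.pi_ne_zero, Complex.I_ne_zero]
  have hc : (((a : ℝ) / M : ℝ) : ℂ) = (((b : ℝ) / M : ℝ) : ℂ) + n := by
    apply mul_left_cancel₀ h2
    rw [hn]; ring
  have hr : (a : ℝ) / M = (b : ℝ) / M + n := by exact_mod_cast hc
  have hMr : (M : ℝ) ≠ 0 := Nat.cast_ne_zero.2 hM
  have hab : (a : ℝ) = b + n * M := by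
    field_simp at hr
    linarith [hr]
  have habz : a - b = n * M := by
    have : (a : ℝ) - b = n * M := by linarith
    exact_mod_cast this
  have hnat : (a - b).natAbs = n.natAbs * M := by
    rw [habz, Int.natAbs_mul, Int.natAbs_natCast]
  rcases Nat.eq_zero_or_pos n.natAbs with hn0 | hn0
  · have hn' : n = 0 := Int.natAbs_eq_zero.1 hn0
    rw [hn', Int.cast_zero, zero_mul, add_zero] at hab
    exact_mod_cast hab
  · exfalso
    have : (a - b).natAbs ≥ M := by rw [hnat]; exact Nat.le_mul_of_pos_left M hn0
    rw [hMdef] at this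
    omega

/-- `E_δ(eᵢ, eⱼ) = (E_δ)ᵢⱼ` read through `Pi.single`. [folklore] -/
private theorem single_dotProduct_mulVec_single (G : Matrix (Fin g ⊕ Fin g) (Fin g ⊕ Fin g) ℤ) (i j : Fin g ⊕ Fin g) :
    Pi.single i (1 : ℤ) ⬝ᵥ G *ᵥ Pi.single j 1 = G i j := by
  classical
  rw [Matrix.mulVec_single_one, single_dotProduct, one_mul]
  rfl

/-! ### §2 Per-fibre: the Gram-matrix reading of the Weil pairing, and admissibility of a frame from its readings -/

/-- **D5 in the chart's model `ℂ^g`** (★ `AbelianVariety.weilPairingLevel_eq_cexp_intGram`, re-typed over `Fin g` through `dim A = g`): the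
Weil pairing of `Θ` on the chart points at `x̃∕M`, `ỹ∕M` is `e(ᵗx̃ G ỹ ∕ M)`, `G = intGram Φ E`, `E = c₁([𝒪(Θ)^an])`.
[cite: Lange2023AbelianVarietiesComplex, §1.5.1 and §2.7.4 Exercise (3)] [cite: Milne1986AbelianVarieties, §16 (p. 132)] -/
theorem weilPairingLevel_chart_eq_cexp (X : AbelianVariety ℂ) (hdim : X.dim = g)
    {Φ : (Fin g ⊕ Fin g → ℝ) ≃L[ℝ] (Fin g → ℂ)} {φ : ComplexTorus Φ → X.Points ℂ}
    (hφ : IsAnalytification (Fin g → ℂ) X.X X.dim φ) (hadd : ∀ x y, φ (x + y) = φ x * φ y)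
    (Θ : CartierDivisor X.X.left) (p : AHData Φ) (hp : AHData.toPic p = picClass (cartierDivisorLineBundle hφ Θ))
    {M : ℕ} [IsDominant (AbelianVariety.Hom.toSchemeHom ((M : ℤ) • 𝟙 X))] (hM : M ≠ 0)
    (x y : Fin g ⊕ Fin g → ℤ) (P Q : X.torsionPoints ℂ M)
    (hP : (P : X.Points ℂ) = φ (proj Φ ((M : ℝ)⁻¹ • fun i ↦ (x i : ℝ))))
    (hQ : (Q : X.Points ℂ) = φ (proj Φ ((M : ℝ)⁻¹ • fun i ↦ (y i : ℝ)))) :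
    (X.weilPairingLevel Θ P Q : ℂ) = cexp (2 * π * I * ((((x ⬝ᵥ (intGram Φ p.form) *ᵥ y : ℤ) : ℝ) / M : ℝ) : ℂ)) := by
  subst hdim
  exact AbelianVariety.weilPairingLevel_eq_cexp_intGram hφ hadd hM Θ p hp x y P Q hP hQ

/-- **ADMISSIBILITY OF A FRAME FROM ITS READINGS (per fibre).**  Let `φ : ComplexTorus Φ → A(ℂ)` be an additive analytification of a
complex abelian variety of dimension `g`, `Θ` an ample divisor with an Appell–Humbert datum `p` of `[𝒪(Θ)^an]`, and suppose the Weil pairings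
of `Θ` on the chart points at `x̃∕M`, `ỹ∕M` are the STANDARD ones `e(ᵗx̃ E_δ ỹ ∕ M)` at every level `M ≥ 1`.  Then (D5 ★
`weilPairingLevel_eq_cexp_intGram` and `M → ∞`) the integer Gram matrix of `c₁(Θ^an)` in the frame `Φ` IS `E_δ`; since `c₁(Θ^an)` is a Riemann form
(★ `isRiemannForm_of_isAmple`), the standard basis is a Frobenius basis of type `δ`, so (★ `exists_siegelAdelicMarking_normalForm` with trivial
base change, read through ★ `ComplexTorus.exists_mapMatrix_linear_of_mdifferentiable`) there is `Z ∈ 𝔥_g` with `Φ = C ∘ Π_Z`, `C` `ℂ`-linear: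
the frame `Φ` is `ℂ`-LINEAR FOR `J(Z)` and `J_Φ = J(Z)` — the Riemann relations of [LangeBirkenhake1992] §4.2 in the tree's marking currency.
[cite: LangeBirkenhake1992, §4.2 Thm. 4.2.1 and §8.1 Prop. 8.1.1] [cite: Lange2023AbelianVarietiesComplex, §1.5.1, §3.1.1 Prop. 3.1.1]
[cite: Milne1986AbelianVarieties, §16 (p. 132)] -/
theorem intGram_eq_typeForm_of_chartReadings (hδ : ∀ i, 0 < δ i) (X : AbelianVariety ℂ) (hdim : X.dim = g)
    {Φ : (Fin g ⊕ Fin g → ℝ) ≃L[ℝ] (Fin g → ℂ)} {φ : ComplexTorus Φ → X.Points ℂ}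
    (hφ : IsAnalytification (Fin g → ℂ) X.X X.dim φ) (hadd : ∀ x y, φ (x + y) = φ x * φ y)
    (Θ : CartierDivisor X.X.left) (hΘ : Θ.IsAmple)
    (p : AHData Φ) (hp : AHData.toPic p = picClass (cartierDivisorLineBundle hφ Θ))
    (hread : ∀ ⦃M : ℕ⦄ (hM : M ≠ 0) (x y : Fin g ⊕ Fin g → ℤ) (P Q : X.torsionPoints ℂ (M : ℤ)),
      (P : X.Points ℂ) = φ (proj Φ ((M : ℝ)⁻¹ • fun i ↦ (x i : ℝ))) →
      (Q : X.Points ℂ) = φ (proj Φ ((M : ℝ)⁻¹ • fun i ↦ (y i : ℝ))) →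
      haveI := AbelianVariety.isDominant_toSchemeHom_zsmul_of_ne_zero X (Nat.cast_ne_zero.2 hM : (M : ℂ) ≠ 0)
      (X.weilPairingLevel Θ P Q : ℂ) = cexp (2 * π * I * ((((x ⬝ᵥ (typeForm δ) *ᵥ y : ℤ) : ℝ) / M : ℝ) : ℂ))) :
    intGram Φ p.form = typeForm δ ∧
    ∃ (Z : Matrix (Fin g) (Fin g) ℂ) (_ : Z ∈ siegelUpperHalfSpace g),
      (∀ v, Φ (jOfSiegel δ Z *ᵥ v) = Complex.I • Φ v) ∧ ComplexTorus.jMatrix Φ = jOfSiegel δ Z := by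
  classical
  subst hdim
  -- (1) the Gram matrix is `E_δ`, entry by entry, from the readings at all levels
  have hG : intGram Φ p.form = typeForm δ := by
    ext i j
    apply int_eq_of_forall_cexp_eq
    intro M hM
    haveI := AbelianVariety.isDominant_toSchemeHom_zsmul_of_ne_zero X (Nat.cast_ne_zero.2 hM : (M : ℂ) ≠ 0)
    obtain ⟨P, hP⟩ := exists_torsionPoint_chart X hadd hM (Pi.single i 1)
    obtain ⟨Q, hQ⟩ := exists_torsionPoint_chart X hadd hM (Pi.single j 1)
    have h1 := weilPairingLevel_chart_eq_cexp X rfl hφ hadd Θ p hp hM (Pi.single i 1) (Pi.single j 1) P Q hP hQ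
    have h2 := hread hM (Pi.single i 1) (Pi.single j 1) P Q hP hQ
    rw [single_dotProduct_mulVec_single] at h1 h2
    rw [← h1, ← h2]
  refine ⟨hG, ?_⟩
  -- (2) `c₁(Θ^an)` is a Riemann form; the standard basis is a Frobenius basis of type `δ`
  have hR : IsRiemannForm Φ p.form := X.isRiemannForm_of_isAmple hφ hadd hΘ p hp
  have hb : Literature.LinearAlgebra.FreeModule.IsFrobeniusBasis (Matrix.toBilin' (intGram Φ p.form)) (Pi.basisFun ℤ (Fin X.dim ⊕ Fin X.dim)) δ := by
    rw [hG]
    refine ⟨fun i j => ?_, fun i j => ?_, fun i j => ?_⟩ <;>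
      simp only [Pi.basisFun_apply, Matrix.toBilin'_single, typeForm, Matrix.fromBlocks_apply₁₁,
        Matrix.fromBlocks_apply₂₂, Matrix.fromBlocks_apply₁₂, Matrix.zero_apply, Matrix.diagonal_apply]
  -- (3) the normal form with trivial base change: `Φ = C ∘ Π_Z`
  obtain ⟨Z, hZ, T, hT, -, ⟨h, hh, hhol, -⟩, -⟩ :=
    exists_siegelAdelicMarking_normalForm X rfl hδ φ hφ hadd hR (Pi.basisFun ℤ (Fin X.dim ⊕ Fin X.dim)) hb
  have hT1 : T = 1 := by
    ext i k
    rw [hT k i, Pi.basisFun_apply, Pi.single_apply, Matrix.one_apply]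
  obtain ⟨A, C, hA, hC⟩ := ComplexTorus.exists_mapMatrix_linear_of_mdifferentiable (h := h.toAddMonoidHom)
    (hhol.mdifferentiable (by simp))
  have hA1 : A = 1 := by
    apply ComplexTorus.mapMatrix_injective (Φ := siegelPeriodEquiv hδ hZ) (Φ' := Φ)
    rw [← hA, ← hT1]
    funext x
    exact hh x
  have hΦC : ∀ x, Φ x = C (siegelPeriodEquiv hδ hZ x) := fun x => by
    have := hC x
    rwa [hA1, Matrix.map_one _ Int.cast_zero Int.cast_one, Matrix.one_mulVec] at this
  have hPJ : ∀ x, siegelPeriodEquiv hδ hZ (jOfSiegel δ Z *ᵥ x) = Complex.I • siegelPeriodEquiv hδ hZ x := by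
    intro x
    rw [← SiegelModuli.jMatrix_siegelPeriodEquiv hδ hZ, ComplexTorus.jMatrix_mulVec, ComplexTorus.apply_latticeJ]
  have hJ : ∀ v, Φ (jOfSiegel δ Z *ᵥ v) = Complex.I • Φ v := fun v => by
    rw [hΦC, hPJ, map_smul, ← hΦC]
  refine ⟨Z, hZ, hJ, ?_⟩
  -- (4) `J_Φ = J(Z)`
  apply Matrix.toLin'.injective
  apply LinearMap.ext
  intro v
  rw [Matrix.toLin'_apply, Matrix.toLin'_apply, ComplexTorus.jMatrix_mulVec, ComplexTorus.latticeJ_apply, ← hJ,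
    ContinuousLinearEquiv.symm_apply_apply]

/-! ### §3 THE HEAD (FLAT-c): the frame package at `t` from the package at `t₀` and constant readings -/

/-- Rational chart coordinates `x̃∕M` as a real vector. [folklore] -/
private theorem ratVec_div_eq_smul (M : ℕ) (x : Fin g ⊕ Fin g → ℤ) :
    (fun j => (((fun i => (x i : ℚ) / M) j : ℚ) : ℝ)) = (M : ℝ)⁻¹ • fun i => (x i : ℝ) := by
  funext j
  simp only [Pi.smul_apply, smul_eq_mul, Rat.cast_div, Rat.cast_intCast, Rat.cast_natCast]
  ring

/-- **FLAT-c «ADMISSIBLE OF CONSTANT READINGS» — THE FRAME PACKAGE AT `t` FROM THE PACKAGE AT `t₀`.**  Let `P` be a polarised abelian scheme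
with level-`N` structure of type `δ` over `T`, `(Φ₁, ex₁)` a chart of the total space (in the skeleton: a relative exponential chart of
`basePoint hT P.A φA : MA → MT` over a connected `V ∋ t₀, t`; only its frames and fibre maps enter here), with (G) at `t`.  Suppose the frame at `t₀` carries an (ADM)-package `(m₀, Θ₀, Λ₀)` for `(Z₀, r)` (`r ∈ K_δ(1)`) with `m₀.γ = 1`, `m₀.Ψ = Φ₁ t₀` and torus map `=`
fibre map of `ex₁` (★ NORM₀ + ★ ADM-NF), let `Θ` be an ample divisor on `A_t` (an `IsLambdaOfAt` witness of the polarisation), and suppose the chart frame has at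
`t` the SAME level readings (L=) and the SAME Weil-pairing readings (W=) as at `t₀` (the conclusions of FLAT-b: continuity along the chart over a
connected `V`).  THEN the frame `Φ₁ t` is the complex coordinate of an (ADM)-package at `t`: there is `Z ∈ 𝔥_g` with `J_{Φ₁ t} = J(Z)`, a marking `m`
of `A_t` by `[J(Z), r]` with `m.γ = 1`, `m.Ψ = Φ₁ t`, torus map `=` fibre map of `ex₁`, and a symplectic lift `Λ` of `(P.level, Θ)` at `t` matched to
`m.r` through `r`.  Proof: at `t₀` the Gram matrix of `c₁(Θ₀^an)` in the frame is `E_δ` (★ `intGram_eq_typeForm_of_symplecticLift`), so by D5 the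
readings at `t₀` are `e(ᵗx̃ E_δ ỹ∕M)`; (W=) carries them to `t`; §2 gives `intGram = E_δ` at `t` and the `J(Z)`-linearity of `Φ₁ t`; the chart-frame
marking then has standard pairing readings (★ `SiegelAdelicMarking.exists_pairingRead_self_of_intGram_eq_typeForm`) and, by (L=) and the matched
tower at `t₀` (`Λ₀.lift_level`), standard level readings; ★ `SiegelAdelicMarking.exists_symplecticLift_of_levelReading` builds `Λ`.
[cite: BirkenhakeLange2004, §8.7 Lemma 8.7.1] [cite: Milne2005ShimuraVarieties, §6 Thm. 6.11 pp. 74–75 and (63) p. 116]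
[cite: Lan2013PELCompactifications, §1.3.6 Lemma 1.3.6.5 (p. 81)] [cite: Lange2023AbelianVarietiesComplex, §1.5.1, §3.1.1] -/
theorem exists_framePackage_of_readings {N : ℕ} (hδ : IsPolarizationType δ) (hg : 0 < g) (hN : N ≠ 0)
    {T : SchemeOver ℂ} (P : PolarizedAbelianSchemeWithLevel g N δ T.left)
    {MT : Type} {φT : MT → ComplexPoints T} {MA : Type} (φA : MA → ComplexPoints (totalOver T P.A))
    {Φ₁ : MT → ((Fin g ⊕ Fin g → ℝ) ≃L[ℝ] (Fin g → ℂ))} {ex₁ : MT × (Fin g → ℂ) → MA} {t₀ t : MT}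
    -- (G) at `t`: the fibre map of the chart is an additive analytification
    (hGt : ∃ φt : ComplexTorus (Φ₁ t) → (P.A.fibre (φT t).left).toAbelianVariety.Points ℂ,
      IsAnalytification (Fin g → ℂ) (P.A.fibre (φT t).left).toAbelianVariety.X g φt ∧
      (∀ x y, φt (x + y) = φt x * φt y) ∧
      ∀ z : Fin g → ℂ, (φA (ex₁ (t, z))).left = P.A.fibrePointToLeft (φT t).left (φt (cover (Φ₁ t) z)))
    -- the frame package at `t₀` for `(Z₀, r)`
    {r : gspFinAdelic δ} (hr : r ∈ principalLevelSubgroup δ 1)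
    {Z₀ : Matrix (Fin g) (Fin g) ℂ} (hZ₀ : Z₀ ∈ siegelUpperHalfSpace g)
    (m₀ : SiegelAdelicMarking ⟨jOfSiegel δ Z₀, SiegelComplexRecordSystem.jOfSiegel_mem_C0pm hδ.1 hZ₀⟩ r
      (P.A.fibre (φT t₀).left).toAbelianVariety)
    (Θ₀ : CartierDivisor (P.A.fibre (φT t₀).left).toAbelianVariety.X.left) (Λ₀ : P.level.SymplecticLift (φT t₀).left Θ₀ δ)
    (hample₀ : Θ₀.IsAmple) (hlam₀ : P.A.IsLambdaOfAt (φT t₀).left P.D P.pol.lam Θ₀)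
    (htower₀ : ∀ ⦃M : ℕ⦄, N ∣ M → M ≠ 0 → ∀ (x : Fin g ⊕ Fin g → ZMod M) (v : Fin g ⊕ Fin g → ℚ),
      AdelicCongr ((r⁻¹ : gspFinAdelic δ) : GL (Fin g ⊕ Fin g) finAdeleQ) 1 v (fun i => ((x i).val : ℚ) / M) →
        ((Λ₀.lift M (Multiplicative.ofAdd x)) : (P.A.fibre (φT t₀).left).toAbelianVariety.Points ℂ) = m₀.r v)
    (hγ₀ : m₀.γ = 1) (hΨ₀ : ∀ v : Fin g ⊕ Fin g → ℝ, m₀.Ψ v = Φ₁ t₀ v)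
    (hjunc₀ : ∀ z : Fin g → ℂ, P.A.fibrePointToLeft (φT t₀).left (m₀.toFun (cover m₀.Ψ z)) = (φA (ex₁ (t₀, z))).left)
    -- an ample divisor on the fibre at `t` (in the skeleton: an `IsLambdaOfAt` witness of the polarisation, from ADM-NF)
    (Θ : CartierDivisor (P.A.fibre (φT t).left).toAbelianVariety.X.left) (hample : Θ.IsAmple)
    -- (L=) the level readings of the chart frame at `t` are those at `t₀`
    (hlevel : ∀ (i : Fin g ⊕ Fin g) (v : Fin g ⊕ Fin g → ℚ),
      P.A.fibrePointToLeft (φT t₀).left (P.A.restrictPt (φT t₀).left (P.level.σ i)) =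
          (φA (ex₁ (t₀, Φ₁ t₀ (fun j => (v j : ℝ))))).left →
      P.A.fibrePointToLeft (φT t).left (P.A.restrictPt (φT t).left (P.level.σ i)) =
          (φA (ex₁ (t, Φ₁ t (fun j => (v j : ℝ))))).left)
    -- (W=) the Weil-pairing readings of the chart frame at `t` are those at `t₀`
    (hpair : ∀ ⦃M : ℕ⦄ (hMΩ : (M : ℂ) ≠ 0) (v w : Fin g ⊕ Fin g → ℚ)
      (Pt Qt : (P.A.fibre (φT t).left).toAbelianVariety.torsionPoints ℂ (M : ℤ))
      (P₀ Q₀ : (P.A.fibre (φT t₀).left).toAbelianVariety.torsionPoints ℂ (M : ℤ)),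
      P.A.fibrePointToLeft (φT t).left (Pt : (P.A.fibre (φT t).left).toAbelianVariety.Points ℂ) =
          (φA (ex₁ (t, Φ₁ t (fun j => (v j : ℝ))))).left →
      P.A.fibrePointToLeft (φT t).left (Qt : (P.A.fibre (φT t).left).toAbelianVariety.Points ℂ) =
          (φA (ex₁ (t, Φ₁ t (fun j => (w j : ℝ))))).left →
      P.A.fibrePointToLeft (φT t₀).left (P₀ : (P.A.fibre (φT t₀).left).toAbelianVariety.Points ℂ) =
          (φA (ex₁ (t₀, Φ₁ t₀ (fun j => (v j : ℝ))))).left →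
      P.A.fibrePointToLeft (φT t₀).left (Q₀ : (P.A.fibre (φT t₀).left).toAbelianVariety.Points ℂ) =
          (φA (ex₁ (t₀, Φ₁ t₀ (fun j => (w j : ℝ))))).left →
      haveI := AbelianVariety.isDominant_toSchemeHom_zsmul_of_ne_zero (P.A.fibre (φT t).left).toAbelianVariety hMΩ
      haveI := AbelianVariety.isDominant_toSchemeHom_zsmul_of_ne_zero (P.A.fibre (φT t₀).left).toAbelianVariety hMΩ
      (P.A.fibre (φT t).left).toAbelianVariety.weilPairingLevel Θ Pt Qt =
        (P.A.fibre (φT t₀).left).toAbelianVariety.weilPairingLevel Θ₀ P₀ Q₀) :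
    ∃ (Z : Matrix (Fin g) (Fin g) ℂ) (hZ : Z ∈ siegelUpperHalfSpace g),
      ComplexTorus.jMatrix (Φ₁ t) = jOfSiegel δ Z ∧
      ∃ (m : SiegelAdelicMarking ⟨jOfSiegel δ Z, SiegelComplexRecordSystem.jOfSiegel_mem_C0pm hδ.1 hZ⟩ r
            (P.A.fibre (φT t).left).toAbelianVariety)
        (Λ : P.level.SymplecticLift (φT t).left Θ δ),
        (∀ ⦃M : ℕ⦄, N ∣ M → M ≠ 0 → ∀ (x : Fin g ⊕ Fin g → ZMod M) (v : Fin g ⊕ Fin g → ℚ),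
          AdelicCongr ((r⁻¹ : gspFinAdelic δ) : GL (Fin g ⊕ Fin g) finAdeleQ) 1 v (fun i => ((x i).val : ℚ) / M) →
            ((Λ.lift M (Multiplicative.ofAdd x)) : (P.A.fibre (φT t).left).toAbelianVariety.Points ℂ) = m.r v) ∧
        m.γ = 1 ∧ (∀ v : Fin g ⊕ Fin g → ℝ, m.Ψ v = Φ₁ t v) ∧
        ∀ z : Fin g → ℂ, P.A.fibrePointToLeft (φT t).left (m.toFun (cover m.Ψ z)) = (φA (ex₁ (t, z))).left := by
  classical
  have hdim₀ : (P.A.fibre (φT t₀).left).toAbelianVariety.dim = g := P.A.dim_fibre_of_isOfRelDim P.relDim _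
  have hdimt : (P.A.fibre (φT t).left).toAbelianVariety.dim = g := P.A.dim_fibre_of_isOfRelDim P.relDim _
  obtain ⟨φt, hφt, haddt, hjunct⟩ := hGt
  have hφt' : IsAnalytification (Fin g → ℂ) (P.A.fibre (φT t).left).toAbelianVariety.X
      (P.A.fibre (φT t).left).toAbelianVariety.dim φt := by
    rw [hdimt]; exact hφt
  have hΨ₀' : m₀.Ψ = Φ₁ t₀ := by
    ext v i
    rw [hΨ₀]
  -- (A) at `t₀` the Gram matrix of `c₁(Θ₀^an)` in the frame is `E_δ`
  obtain ⟨p₀, hp₀, hG₀⟩ := exists_ahData_intGram_eq_typeForm_of_symplecticLift P.pol hδ hg hN P.hasType hlam₀ hample₀ hr hZ₀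
    m₀ hγ₀ Λ₀ htower₀
  -- (B) chart junctions on lattice coordinates
  have hpt₀ : ∀ v : Fin g ⊕ Fin g → ℝ,
      P.A.fibrePointToLeft (φT t₀).left (m₀.toFun (proj m₀.Ψ v)) = (φA (ex₁ (t₀, Φ₁ t₀ v))).left := by
    intro v
    rw [← hΨ₀', ← ComplexTorus.cover_apply_apply (Φ := m₀.Ψ) v]
    exact hjunc₀ (m₀.Ψ v)
  have hptt : ∀ v : Fin g ⊕ Fin g → ℝ,
      P.A.fibrePointToLeft (φT t).left (φt (proj (Φ₁ t) v)) = (φA (ex₁ (t, Φ₁ t v))).left := by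
    intro v
    rw [hjunct, ComplexTorus.cover_apply_apply]
  -- (C) the readings at `t` are the standard ones `e(ᵗx̃ E_δ ỹ / M)`
  have hread : ∀ ⦃M : ℕ⦄ (hM : M ≠ 0) (x y : Fin g ⊕ Fin g → ℤ)
      (Pt Qt : (P.A.fibre (φT t).left).toAbelianVariety.torsionPoints ℂ (M : ℤ)),
      (Pt : (P.A.fibre (φT t).left).toAbelianVariety.Points ℂ) = φt (proj (Φ₁ t) ((M : ℝ)⁻¹ • fun i ↦ (x i : ℝ))) →
      (Qt : (P.A.fibre (φT t).left).toAbelianVariety.Points ℂ) = φt (proj (Φ₁ t) ((M : ℝ)⁻¹ • fun i ↦ (y i : ℝ))) →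
      haveI := AbelianVariety.isDominant_toSchemeHom_zsmul_of_ne_zero (P.A.fibre (φT t).left).toAbelianVariety
        (Nat.cast_ne_zero.2 hM : (M : ℂ) ≠ 0)
      ((P.A.fibre (φT t).left).toAbelianVariety.weilPairingLevel Θ Pt Qt : ℂ) =
        cexp (2 * π * I * ((((x ⬝ᵥ (typeForm δ) *ᵥ y : ℤ) : ℝ) / M : ℝ) : ℂ)) := by
    intro M hM x y Pt Qt hPt hQt
    have hMΩ : (M : ℂ) ≠ 0 := Nat.cast_ne_zero.2 hM
    haveI := AbelianVariety.isDominant_toSchemeHom_zsmul_of_ne_zero (P.A.fibre (φT t₀).left).toAbelianVariety hMΩ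
    obtain ⟨P₀, hP₀⟩ := exists_torsionPoint_chart _ m₀.toFun_add hM x
    obtain ⟨Q₀, hQ₀⟩ := exists_torsionPoint_chart _ m₀.toFun_add hM y
    have h₀ := weilPairingLevel_chart_eq_cexp _ hdim₀ m₀.isAnalytification m₀.toFun_add Θ₀ p₀ hp₀ hM x y P₀ Q₀ hP₀ hQ₀
    rw [hG₀] at h₀
    rw [← h₀]
    refine hpair hMΩ (fun i => (x i : ℚ) / M) (fun i => (y i : ℚ) / M) Pt Qt P₀ Q₀ ?_ ?_ ?_ ?_
    · rw [hPt, ratVec_div_eq_smul]; exact hptt _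
    · rw [hQt, ratVec_div_eq_smul]; exact hptt _
    · rw [hP₀, ratVec_div_eq_smul]; exact hpt₀ _
    · rw [hQ₀, ratVec_div_eq_smul]; exact hpt₀ _
  -- (D) the Gram matrix at `t` is `E_δ`; the frame is `J(Z)`-linear
  obtain ⟨pt, hpt⟩ := AHData.toPic_surjective (picClass (cartierDivisorLineBundle hφt' Θ))
  obtain ⟨hGt, Z, hZ, hJ, hjM⟩ := intGram_eq_typeForm_of_chartReadings hδ.1 _ hdimt hφt' haddt Θ hample pt hpt hread
  -- (E) the chart-frame marking at `t`
  have h1 : ((((1 : GL (Fin g ⊕ Fin g) ℚ)⁻¹ : GL (Fin g ⊕ Fin g) ℚ) : Matrix (Fin g ⊕ Fin g) (Fin g ⊕ Fin g) ℚ).map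
      (algebraMap ℚ ℝ)) = 1 := by
    rw [inv_one, Units.val_one]; exact Matrix.map_one _ (map_zero _) (map_one _)
  let mt : SiegelAdelicMarking ⟨jOfSiegel δ Z, SiegelComplexRecordSystem.jOfSiegel_mem_C0pm hδ.1 hZ⟩ r
      (P.A.fibre (φT t).left).toAbelianVariety :=
    { γ := 1
      γ_isLatticeBasis := isLatticeBasis_one_of_mem_principalLevelSubgroup_one hr
      Ψ := Φ₁ t
      Ψ_J := fun x => by
        rw [h1, Matrix.one_mulVec, Matrix.one_mulVec]
        exact hJ x
      toFun := φt
      isAnalytification := hφt'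
      toFun_add := haddt }
  have hmt_r : ∀ v : Fin g ⊕ Fin g → ℚ, mt.r v = φt (proj (Φ₁ t) fun i => ((v i : ℚ) : ℝ)) := fun v =>
    mt.r_eq_toFun_proj_of_γ_eq_one rfl v
  -- (F) pairing readings of the chart-frame marking
  obtain ⟨ζ, hζ, hζpow, hpair_t⟩ := mt.exists_pairingRead_self_of_intGram_eq_typeForm hδ hg rfl Θ (N := N) pt hpt hGt hr
  -- (G) level readings of the chart-frame marking, from `t₀` through (L=)
  have hlevel_t : ∀ i : Fin g ⊕ Fin g, ∃ v : Fin g ⊕ Fin g → ℚ,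
      AdelicCongr ((r⁻¹ : gspFinAdelic δ) : GL (Fin g ⊕ Fin g) finAdeleQ) 1 v
          (fun j => (((Pi.single i (1 : ZMod N) : Fin g ⊕ Fin g → ZMod N) j).val : ℚ) / N) ∧
        P.A.restrictPt (φT t).left (P.level.σ i) = mt.r v := by
    intro i
    obtain ⟨v, hv⟩ := SiegelAdelicMarking.exists_adelicCongr_inv_one (a := r)
      (fun j => (((Pi.single i (1 : ZMod N) : Fin g ⊕ Fin g → ZMod N) j).val : ℚ) / N)
    refine ⟨v, hv, ?_⟩
    have h0 : P.A.restrictPt (φT t₀).left (P.level.σ i) = m₀.toFun (proj m₀.Ψ fun j => ((v j : ℚ) : ℝ)) := by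
      rw [← Λ₀.lift_level i, htower₀ (dvd_refl N) hN (Pi.single i 1) v hv, m₀.r_eq_toFun_proj_of_γ_eq_one hγ₀]
    have h0' := congrArg (P.A.fibrePointToLeft (φT t₀).left) h0
    rw [hpt₀] at h0'
    have ht' := hlevel i v h0'
    rw [← hptt] at ht'
    rw [hmt_r]
    exact P.A.fibrePointToLeft_injective _ ht'
  -- (H) the symplectic lift matched to the marking
  obtain ⟨Λ, -, hΛ⟩ :=
    SiegelAdelicMarking.exists_symplecticLift_of_levelReading P.level Θ mt ζ hζ hζpow hpair_t hlevel_t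
  refine ⟨Z, hZ, hjM, mt, Λ, hΛ, rfl, fun v => rfl, fun z => ?_⟩
  show P.A.fibrePointToLeft (φT t).left (φt (cover (Φ₁ t) z)) = _
  rw [← hjunct]
end Literature.AlgebraicGeometry.ModuliOfAbelianVarieties

end
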